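import Literature.NumberTheory.EllipticCurves.HeathBrown1994.CongruentTwoSelmerMonskyMatrix
import Mathlib.LinearAlgebra.Matrix.Determinant.Basic
import Mathlib.Data.Fintype.BigOperators
import HarnessLib

/-!
# Crux stmt-BirchSwinnertonDyer-20509 `RamifiedOffTYZOfFacts`, line `offtyz-v7` — the Q-FORM IDENTITY (★), TYPED
# (LEAD cruxlead-20509 g5, cycle 6, 2026-08-28; crux WORKFILE, not a Theorems file: it states a CONJECTURE)

Companion of `Lines/offtyz_v7_QForm.md`. Nothing here is asserted: the file DEFINES the two sides of the identity (★) of that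
note purely in terms of the tree's Monsky data (`HeathBrown1994.legendreMatrix`, `legendreDiagonal`, `monskyMatrixOdd`) and
states (★) as a `Prop` (`QFormIdentity`), in the linear form (★a) ∧ (★b) of the note §4, with the coefficient
«𝓛(n/d) odd» replaced by «det M_{n/d} = 1» (Smith 2016 Thm 1.2 = Tian–Yuan–Zhang Thm 1.1 read through Monsky; both in print).

MEANING (note §1–§3, paper level, from TYZ 2017 §3 as printed + Hochschild–Serre + class field theory of the conductor-2 ring class
fields): for square-free `n = p₁⋯p_k ≡ 5 (mod 8)` the Galois-mover class of TYZ's genus point `P(n)` over `F = ℚ(i, √p₁, …, √p_k)` has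
an invariant `Q_n ∈ H²(Gal(F/ℚ), 𝔽₂) = 𝔽₂[x_{−1}, x_{p₁}, …, x_{p_k}]₂` with «mover ⟺ Q_n ≠ 0», and
`Q_n = Σ_{d ∣ n, d ≡ 5 (8), 𝓛(n/d) odd, corank A_d = 1} x_{D₁(d)} x_{D₂(d)}` where `A_d` = `legendreMatrix` of the primes of `d`
(= Rédei matrix of `ℚ(√−d)`, `d ≡ 1 (mod 4)`), its corank-one LEFT null vector `u_d` names the Rédei decomposition of the second
kind `−16d ∼ D₁·D₂` (`D₁ = ∏_{i ∈ u_d} pᵢ^*`), and the monomial content of `x_{D₁}x_{D₂}` is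
`Σ_{i<j} (u_i[p_j ∣ d] + u_j[p_i ∣ d]) x_{p_i}x_{p_j} + Σ_i (u_i + ε_d [p_i ∣ d]) x_{−1}x_{p_i}`, `ε_d = Σ_{i} u_i·(−1/p_i)_+`.
(★) says `Q_n = q(κ_n)` with `κ_n = Σ_{v ∈ ker M_n} v = (a; b)` and `q(a;b) = x_a x_{n/a} + x_b x_{−n/b}`, i.e. coefficientwise
  (★b) `b_i = Σ_d det(M_{n/d})·(u_{d,i} + ε_d [p_i ∣ d])`,   (★a) `(a+b)_i + (a+b)_j = Σ_d det(M_{n/d})·(u_{d,i}[p_j ∣ d] + u_{d,j}[p_i ∣ d])`.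
EVIDENCE: 0 exceptions on all 14 893 Legendre sign patterns with k ≤ 5 and on 50 000 random patterns k ≤ 8 (instrument `qform.py`,
evidence on 20509). CONSEQUENCE granted (★) + the note's §1–§3: for every square-free n ≡ 5 (mod 8) with `#Sel₂(E_n) = 8`, a mover
exists, hence (kernel door `GaloisMotion.rankOne_sha_bsdp_two_congruentNumberCurve_of_selmerEight_of_mover`, p672160) `𝓛(n)` odd,
`ord = rank = 1`, `Ш[2^∞] = 0`, `BSD(E_n, 2)`. BSD is not proved by any of this; nothing is asserted in this file.
-/

namespace Summit.BirchSwinnertonDyer.PrintCf2.QForm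

open Finset Matrix Literature.NumberTheory.EllipticCurves.HeathBrown1994

variable {k : ℕ}

/-- Sum of all vectors of the right kernel of a square matrix over `𝔽₂`: the null vector when the corank is `1`, `0` otherwise
(a subspace of dimension `≠ 1` sums to `0`). [folklore] -/
def kerSum {m : Type*} [Fintype m] [DecidableEq m] (M : Matrix m m (ZMod 2)) : m → ZMod 2 :=
  ∑ v : m → ZMod 2, if M.mulVec v = 0 then v else 0

/-- Sum of all vectors of the LEFT kernel (`uᵀ M = 0`). [folklore] -/
def leftKerSum {m : Type*} [Fintype m] [DecidableEq m] (M : Matrix m m (ZMod 2)) : m → ZMod 2 :=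
  kerSum Mᵀ

/-- Monsky's kernel sum `κ_n = (a; b)` of `M_n = monskyMatrixOdd p`. [cite: HeathBrown1994SelmerCongruentII, Appendix (Monsky), typescript p. 39 L27–L33] -/
def kappa (p : Fin k → ℕ) : Fin k ⊕ Fin k → ZMod 2 :=
  kerSum (monskyMatrixOdd p)

/-- `a`-part of `κ_n` (Monsky's first block: the class of `x + n`). [cite: HeathBrown1994SelmerCongruentII, Appendix (Monsky), typescript p. 39 L27–L33] -/
def kappaA (p : Fin k → ℕ) (i : Fin k) : ZMod 2 := kappa p (Sum.inl i)

/-- `b`-part of `κ_n` (Monsky's second block: the class of `x`). [cite: HeathBrown1994SelmerCongruentII, Appendix (Monsky), typescript p. 39 L27–L33] -/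
def kappaB (p : Fin k → ℕ) (i : Fin k) : ZMod 2 := kappa p (Sum.inr i)

/-- The primes of a sub-block `S ⊆ {p₁, …, p_k}` re-indexed by `Fin #S` (increasing order; any re-indexing conjugates the matrices
by a permutation and changes neither determinants nor kernel sums read back on `S`). [folklore] -/
def blockPrimes (p : Fin k → ℕ) (S : Finset (Fin k)) : Fin S.card → ℕ := fun t => p (S.orderIsoOfFin rfl t)

/-- Rédei/Monsky matrix `A_d` of the sub-block `d = ∏_{i ∈ S} pᵢ` (diagonal recomputed inside the block).
[cite: HeathBrown1994SelmerCongruentII, Appendix (Monsky), typescript p. 39 L13–L26] -/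
def blockLegendreMatrix (p : Fin k → ℕ) (S : Finset (Fin k)) : Matrix (Fin S.card) (Fin S.card) (ZMod 2) :=
  legendreMatrix (blockPrimes p S)

/-- Monsky's matrix of the complementary block `n/d`. [cite: HeathBrown1994SelmerCongruentII, Appendix (Monsky), typescript p. 39 L27–L33] -/
def coblockMonsky (p : Fin k → ℕ) (S : Finset (Fin k)) :
    Matrix (Fin Sᶜ.card ⊕ Fin Sᶜ.card) (Fin Sᶜ.card ⊕ Fin Sᶜ.card) (ZMod 2) :=
  monskyMatrixOdd (blockPrimes p Sᶜ)

/-- The weight `σ(n/d) := det M_{n/d} ∈ 𝔽₂` (`= [s(n/d) = 0]` = `[𝓛(n/d) odd]` by Smith 2016 Thm 1.2; `det` of the empty matrix is `1`).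
[cite: Smith2016CongruentDensity, Thm 1.2 and Thm 2.2] -/
def coblockWeight (p : Fin k → ℕ) (S : Finset (Fin k)) : ZMod 2 :=
  (coblockMonsky p S).det

/-- The corank-one left null vector `u_d` of `A_d` as the LEFT kernel sum (automatically `0` when the corank is `≥ 2`;
corank `0` never occurs since the row sums of `A_d` vanish), extended by `0` outside the block. [folklore] -/
def blockNull (p : Fin k → ℕ) (S : Finset (Fin k)) (i : Fin k) : ZMod 2 :=
  if h : i ∈ S then leftKerSum (blockLegendreMatrix p S) ((S.orderIsoOfFin rfl).symm ⟨i, h⟩) else 0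

/-- `ε_d := Σ_{i ∈ d} u_{d,i} · (−1/pᵢ)_+` (parity of the number of primes `≡ 3 (mod 4)` in `D₁(d)`; the sign of `D₁`). [folklore] -/
def blockSign (p : Fin k → ℕ) (S : Finset (Fin k)) : ZMod 2 :=
  ∑ i ∈ S, blockNull p S i * addLegendreSym (-1) (p i)

/-- The admissible blocks: `d = ∏_{i∈S} pᵢ ≡ 5 (mod 8)` (for `n ≡ 5 (mod 8)` this forces `n/d ≡ 1 (mod 8)`), as a Boolean test. [folklore] -/
def admissible (p : Fin k → ℕ) (S : Finset (Fin k)) : Bool :=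
  decide ((∏ i ∈ S, p i) % 8 = 5)

/-- Right side of (★b) at the prime `pᵢ`: the `x_{−1}x_{pᵢ}`-coefficient of `Q_n`,
`Σ_{d admissible} det(M_{n/d}) · (u_{d,i} + ε_d [pᵢ ∣ d])`. [folklore] -/
def rhsB (p : Fin k → ℕ) (i : Fin k) : ZMod 2 :=
  ∑ S ∈ (Finset.univ : Finset (Finset (Fin k))).filter (fun S => admissible p S),
    coblockWeight p S * (blockNull p S i + (if i ∈ S then blockSign p S else 0))

/-- Right side of (★a) at the pair `pᵢ, p_j`: the `x_{pᵢ}x_{p_j}`-coefficient of `Q_n`,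
`Σ_{d admissible} det(M_{n/d}) · (u_{d,i}[p_j ∣ d] + u_{d,j}[pᵢ ∣ d])`. [folklore] -/
def rhsA (p : Fin k → ℕ) (i j : Fin k) : ZMod 2 :=
  ∑ S ∈ (Finset.univ : Finset (Finset (Fin k))).filter (fun S => admissible p S),
    coblockWeight p S * ((if j ∈ S then blockNull p S i else 0) + (if i ∈ S then blockNull p S j else 0))

/-- **CONJECTURE (★) (LEAD cruxlead-20509 g5), typed.** For distinct odd primes `p₁, …, p_k` with `∏ pᵢ ≡ 5 (mod 8)`:
(★b) `b_i(κ_n) = rhsB` for every `i`, and (★a) `(a+b)_i(κ_n) + (a+b)_j(κ_n) = rhsA` for every `i ≠ j`.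
Equivalent to `Q_n = q(κ_n)` of the note (the quadratic form `Q_n` has no square monomials). Verified on every sign pattern with
`k ≤ 5` and 50 000 random patterns `k ≤ 8`; OPEN in general. [folklore] -/
def QFormIdentity : Prop :=
  ∀ (k : ℕ) (p : Fin k → ℕ), (∀ i, (p i).Prime) → (∀ i, Odd (p i)) → Function.Injective p →
    (∏ i, p i) % 8 = 5 →
      (∀ i, kappaB p i = rhsB p i) ∧
      (∀ i j, i ≠ j → (kappaA p i + kappaB p i) + (kappaA p j + kappaB p j) = rhsA p i j)

/-- The weaker corollary actually needed by the Galois-mover door: for `n ≡ 5 (mod 8)` with `s(n) = 1` (kernel of `M_n` of order `2`)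
the Q-form is non-zero, i.e. some `rhsB p i ≠ 0` or some `rhsA p i j ≠ 0`. (Follows from `QFormIdentity`: `κ_n ≠ 0` is then the Selmer
class `(a;b)`, and `q(a;b) = 0` would force `b = 0`, `a ∈ {0, 1}`, but `M_n(1;0) = (c₂; c₂) ≠ 0`.) [folklore] -/
def QFormNonvanishing : Prop :=
  ∀ (k : ℕ) (p : Fin k → ℕ), (∀ i, (p i).Prime) → (∀ i, Odd (p i)) → Function.Injective p →
    (∏ i, p i) % 8 = 5 → monskySelmerRankOdd p = 1 →
      (∃ i, rhsB p i ≠ 0) ∨ (∃ i j, i ≠ j ∧ rhsA p i j ≠ 0)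

end Summit.BirchSwinnertonDyer.PrintCf2.QForm

/-! ## Sanity evaluations (closed computations; match the instrument `qform.py`) -/

namespace Summit.BirchSwinnertonDyer.PrintCf2.QForm

open Literature.NumberTheory.EllipticCurves.HeathBrown1994

/-- `n = 5`: `κ = (1; 1)` and `rhsB = 1`: the single block `d = 5` (`u = (1)`, `ε = 0`) gives `Q_5 = x_{−1}x_5 = q(1;1)`. [folklore] -/
example : kappaB ![5] 0 = 1 ∧ rhsB ![5] 0 = 1 ∧ kappaA ![5] 0 = 1 := by native_decide

/-- `n = 13·17 = 221` (type (5,1) mod 8, `(13/17) = +1`, the jump-one census member: `s = 3`): `κ = 0` and `Q = 0`. [folklore] -/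
example : kappaB ![13, 17] 0 = 0 ∧ kappaB ![13, 17] 1 = 0 ∧ rhsB ![13, 17] 0 = 0 ∧ rhsB ![13, 17] 1 = 0 ∧
    rhsA ![13, 17] 0 1 = 0 := by native_decide

/-- `n = 5·41 = 205`?  No: `(5/41) = +1`, jump-one (`s = 3`), `Q = 0`; and `n = 3·7 = 21` (type (3,7), `(7/3) = +1`): `s = 1`,
`κ = (a;b) = (0…; …)`, `(★b)` and `(★a)` hold. [folklore] -/
example : (kappaB ![3, 7] 0 = rhsB ![3, 7] 0) ∧ (kappaB ![3, 7] 1 = rhsB ![3, 7] 1) ∧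
    ((kappaA ![3, 7] 0 + kappaB ![3, 7] 0) + (kappaA ![3, 7] 1 + kappaB ![3, 7] 1) = rhsA ![3, 7] 0 1) := by
  native_decide

/-- `n = 1645 = 5·7·47` (type (5,7,7), `(5/7) = (5/47) = −1`: g4's TYZ-silent mover family; `s = 1`): (★) holds and `Q ≠ 0`. [folklore] -/
example : (∀ i : Fin 3, kappaB ![5, 7, 47] i = rhsB ![5, 7, 47] i) ∧
    (∀ i j : Fin 3, i ≠ j → (kappaA ![5, 7, 47] i + kappaB ![5, 7, 47] i) + (kappaA ![5, 7, 47] j + kappaB ![5, 7, 47] j)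
      = rhsA ![5, 7, 47] i j) ∧ (∃ i : Fin 3, rhsB ![5, 7, 47] i ≠ 0) := by native_decide

/-- `n = 165 = 3·5·11` (type (3,5,3)): (★) holds. [folklore] -/
example : (∀ i : Fin 3, kappaB ![3, 5, 11] i = rhsB ![3, 5, 11] i) ∧
    (∀ i j : Fin 3, i ≠ j → (kappaA ![3, 5, 11] i + kappaB ![3, 5, 11] i) + (kappaA ![3, 5, 11] j + kappaB ![3, 5, 11] j)
      = rhsA ![3, 5, 11] i j) := by native_decide

end Summit.BirchSwinnertonDyer.PrintCf2.QForm

/-! ## The Ω-form of (★) (note §11): real Rédei null vectors of the blocks, Monsky determinants of the co-blocks -/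

namespace Summit.BirchSwinnertonDyer.PrintCf2.QForm

open Finset Matrix Literature.NumberTheory.EllipticCurves.HeathBrown1994

variable {k : ℕ}

/-- The REAL Rédei matrix `N_d = A_d + D₋₁` of the block `d` (`= A_dᵀ + c₋₁c₋₁ᵀ` by quadratic reciprocity, landed as
`MonskyRedeiForm.legendreMatrix_transpose`). [folklore] -/
def blockRealRedei (p : Fin k → ℕ) (S : Finset (Fin k)) : Matrix (Fin S.card) (Fin S.card) (ZMod 2) :=
  legendreMatrix (blockPrimes p S) + legendreDiagonal (blockPrimes p S) (-1)

/-- `ρ(N_d)`: the right kernel sum of the real Rédei matrix of the block, read back on `Fin k` (zero outside the block). For `d ≡ 5 (8)`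
it equals `u_d + ε_d·1_d` (note §11). [folklore] -/
def blockRho (p : Fin k → ℕ) (S : Finset (Fin k)) (i : Fin k) : ZMod 2 :=
  if h : i ∈ S then kerSum (blockRealRedei p S) ((S.orderIsoOfFin rfl).symm ⟨i, h⟩) else 0

/-- **`Ω_n := Σ_{d admissible} det(M_{n/d}) · ρ(N_d) · 1_dᵀ`** (a `k × k` matrix over `𝔽₂`). [folklore] -/
def Omega (p : Fin k → ℕ) : Matrix (Fin k) (Fin k) (ZMod 2) :=
  Matrix.of fun i j => ∑ S ∈ (Finset.univ : Finset (Finset (Fin k))).filter (fun S => admissible p S),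
    coblockWeight p S * blockRho p S i * (if j ∈ S then 1 else 0)

/-- **(★), Ω-form** (equivalent to `QFormIdentity`, note §11): for distinct odd primes with `∏ pᵢ ≡ 5 (mod 8)`, writing
`κ_n = (d₊; d₋)` and `d₀ = d₊ + d₋`: `diag Ω_n = d₋` and `Ω_n + Ω_nᵀ = d₀1ᵀ + 1d₀ᵀ` off the diagonal — i.e. `Ω_n + d₀·1ᵀ` is symmetric
with diagonal `d₊`. [folklore] -/
def QFormIdentityOmega : Prop :=
  ∀ (k : ℕ) (p : Fin k → ℕ), (∀ i, (p i).Prime) → (∀ i, Odd (p i)) → Function.Injective p →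
    (∏ i, p i) % 8 = 5 →
      (∀ i, Omega p i i = kappaB p i) ∧
      (∀ i j, i ≠ j → Omega p i j + Omega p j i = (kappaA p i + kappaB p i) + (kappaA p j + kappaB p j))

/-- Sanity: the Ω-form at `n = 5`, `21 = 3·7`, `1645 = 5·7·47`, `165 = 3·5·11` (closed computations). [folklore] -/
example : (Omega ![5] 0 0 = kappaB ![5] 0) ∧
    (∀ i : Fin 2, Omega ![3, 7] i i = kappaB ![3, 7] i) ∧
    (Omega ![3, 7] 0 1 + Omega ![3, 7] 1 0 = (kappaA ![3, 7] 0 + kappaB ![3, 7] 0) + (kappaA ![3, 7] 1 + kappaB ![3, 7] 1)) ∧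
    (∀ i : Fin 3, Omega ![5, 7, 47] i i = kappaB ![5, 7, 47] i) ∧
    (∀ i j : Fin 3, i ≠ j → Omega ![5, 7, 47] i j + Omega ![5, 7, 47] j i =
      (kappaA ![5, 7, 47] i + kappaB ![5, 7, 47] i) + (kappaA ![5, 7, 47] j + kappaB ![5, 7, 47] j)) ∧
    (∀ i : Fin 3, Omega ![3, 5, 11] i i = kappaB ![3, 5, 11] i) ∧
    (∀ i j : Fin 3, i ≠ j → Omega ![3, 5, 11] i j + Omega ![3, 5, 11] j i =
      (kappaA ![3, 5, 11] i + kappaB ![3, 5, 11] i) + (kappaA ![3, 5, 11] j + kappaB ![3, 5, 11] j)) := by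
  native_decide

end Summit.BirchSwinnertonDyer.PrintCf2.QForm
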